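import Summits.PneNP.PneNP.Theorems.ChebyshevTracialDesignLqConstantsScale
import HarnessLib

/-!
# Cell pnp-psdrank, route `ChebyshevTracialDesign`: the γ-direction numerics for brick 130's inputs (iii) and (i) — `ε_B ≤ ¼`, `ε_C ≤ ¼`,
# `q ≤ ½` for `P ≥ P*` (crux `TracialDecayExp20`, stmt-PneNP-19878)

Brick 140b (eng g26; MEMO-30 §4 «126b-type numerics», MEMO-25 (eng) §1 SIZE). Bricks 137/137b give brick 130's `(hBm)` with
`ε_B = (m(Γ₁(2q₁ + 3D/s) + 2Γ₀q₀) + D(4/3)^D((2s/n + 4D/n)·aT₁ + mT₀)/LB)/√cV` and `(hC)` with `ε_C = 2Γ₀q₀ + D(4/3)^D T₀/LB`; brick 140a bounds Lq's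
constants in the scale `P` (`N₀ = P⁸`): `Γ_i ≤ c_Γ P`, `0 ≤ q_i ≤ c_q/P⁶`. This file is the remaining real arithmetic, with every structural quantity entering
ONLY through its scale: `0 ≤ m ≤ P⁸` (`m ≤ a ≤ N₀`, brick 137b `condMean_mem_Icc`), `βP⁸ ≤ s ≤ P⁸` (balanced cut), `n = 2P⁸`, `0 ≤ D ≤ 2P²`, `0 ≤ a ≤ P⁸`,
`T₁ ≤ T₀` (brick 140a `exp_far_mono`), the far-term budget `D(4/3)^D T₀ ≤ LB/(2P⁹)` (brick 124a's `R` with ONE MORE `(9/8)·log N₀`), and the variance floor in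
root form `c_r·P⁴ ≤ r = √cV` (lit's (V): `cV = r_V²/2`, `r_V ≍ β√N₀`, so `c_r ≍ β/const`):
* **`epsBC_numerics`**: for `0 < β`, `c_Γ, c_q ≥ 0`, `c_r > 0` there is `P* ≥ 0` such that for `P ≥ P*` (and `1 ≤ P`) all of
  `ε_B ≤ ¼`, `ε_C ≤ ¼`, `q₀ ≤ ½`, `q₁ ≤ ½` hold — so brick 130's `ε_A + ε_B ≤ 1`, `ε_C + ε_B ≤ 1` only ask `ε_A ≤ ¾` of the (hA) brick.
  (`ε_B`'s main term is `≲ (4c_Γc_q + 6c_Γ/β)·P³/(c_r P⁴) = O(P⁻¹)`; its far term `≤ 3P⁸·D(4/3)^DT₀/LB ≤ 1.5/P`; `ε_C = O(P⁻⁵) + O(P⁻⁹)`.)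
Pure real arithmetic. WHAT THIS FILE DOES NOT DO: `ε_A` (brick 139's shape), the choice of `L, R, ε, r_V`, anything combinatorial, anything on
`TracialDecayExp20` itself, psd rank of P_PM(K_n), or P vs NP. [cite: RollinRoss2010, §4.1 Thm 4.2 (the variance scale)] [cite: Agarwal2000DifferenceEquations, Remark 1.8.1]
Stature: support/instrument (kernel lane, no defs, axioms standard). Supports stmt-PneNP-19878.
-/

set_option linter.dupNamespace false -- `Summit.PneNP.PneNP.…`: summit = sub-problem (D-0017)

noncomputable section

namespace Summit.PneNP.PneNP.Theorems.ChebyshevTracialDesignGammaDirectionNumericsBC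

/-- **`ε_B ≤ ¼`, `ε_C ≤ ¼`, `q₀, q₁ ≤ ½` for `P ≥ P*`.** See the module docstring for the meaning of the scale hypotheses; `r` stands for `√cV`.
[cite: RollinRoss2010, §4.1 Thm 4.2 (the variance scale)] [cite: Agarwal2000DifferenceEquations, Remark 1.8.1] -/
theorem epsBC_numerics {β cΓ cq cr : ℝ} (hβ : 0 < β) (hcΓ : 0 ≤ cΓ) (hcq : 0 ≤ cq) (hcr : 0 < cr) :
    ∃ Pstar : ℝ, 0 ≤ Pstar ∧ ∀ P : ℝ, Pstar ≤ P → 1 ≤ P →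
      ∀ Γ₀ Γ₁ q₀ q₁ m s n D a LB T₀ T₁ r : ℝ,
        0 ≤ Γ₀ → Γ₀ ≤ cΓ * P → 0 ≤ Γ₁ → Γ₁ ≤ cΓ * P → 0 ≤ q₀ → q₀ ≤ cq / P ^ 6 → 0 ≤ q₁ → q₁ ≤ cq / P ^ 6 →
        0 ≤ m → m ≤ P ^ 8 → β * P ^ 8 ≤ s → s ≤ P ^ 8 → n = 2 * P ^ 8 → 0 ≤ D → D ≤ 2 * P ^ 2 → 0 ≤ a → a ≤ P ^ 8 →
        0 < LB → 0 ≤ T₁ → T₁ ≤ T₀ → D * (4 / 3 : ℝ) ^ D * T₀ ≤ LB / (2 * P ^ 9) → cr * P ^ 4 ≤ r →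
      (m * (Γ₁ * (2 * q₁ + 3 * D / s) + 2 * Γ₀ * q₀) +
          D * (4 / 3 : ℝ) ^ D * ((2 * s / n + 4 * D / n) * (a * T₁) + m * T₀) / LB) / r ≤ 1 / 4 ∧
      2 * Γ₀ * q₀ + D * (4 / 3 : ℝ) ^ D * T₀ / LB ≤ 1 / 4 ∧ q₀ ≤ 1 / 2 ∧ q₁ ≤ 1 / 2 := by
  obtain ⟨K, hK⟩ : ∃ c : ℝ, c = 4 * cΓ * cq + 6 * cΓ / β + 2 := ⟨_, rfl⟩
  have hK0 : 0 ≤ K := by rw [hK]; positivity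
  refine ⟨2 + 4 * K / cr + 4 * (2 * cΓ * cq + 1) + 2 * cq, by positivity, ?_⟩
  intro P hPstar hP1 Γ₀ Γ₁ q₀ q₁ m s n D a LB T₀ T₁ r hΓ₀0 hΓ₀ hΓ₁0 hΓ₁ hq₀0 hq₀ hq₁0 hq₁ hm0 hm hs hs' hn hD0 hD ha0 ha hLB hT₁0 hT₁
    hfar hr
  have hP0 : 0 < P := by linarith only [hP1]
  have hP2 : 2 ≤ P := by
    have h1 : 0 ≤ 4 * K / cr := by positivity
    have h2 : 0 ≤ 4 * (2 * cΓ * cq + 1) := by positivity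
    linarith only [hPstar, h1, h2, hcq]
  have hPK : 4 * K / cr ≤ P := by
    have h2 : 0 ≤ 4 * (2 * cΓ * cq + 1) := by positivity
    linarith only [hPstar, h2, hcq]
  have hPC : 4 * (2 * cΓ * cq + 1) ≤ P := by
    have h1 : 0 ≤ 4 * K / cr := by positivity
    linarith only [hPstar, h1, hcq]
  have hPq : 2 * cq ≤ P := by
    have h1 : 0 ≤ 4 * K / cr := by positivity
    have h2 : 0 ≤ 4 * (2 * cΓ * cq + 1) := by positivity
    linarith only [hPstar, h1, h2]
  -- powers of `P`
  have hP6 : P ≤ P ^ 6 := le_self_pow₀ hP1 (by norm_num)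
  have hP5 : P ≤ P ^ 5 := le_self_pow₀ hP1 (by norm_num)
  have hP9 : P ≤ P ^ 9 := le_self_pow₀ hP1 (by norm_num)
  have hP4pos : 0 < P ^ 4 := by positivity
  have hP8pos : 0 < P ^ 8 := by positivity
  have hr0 : 0 < r := lt_of_lt_of_le (by positivity) hr
  have hs0 : 0 < s := lt_of_lt_of_le (by positivity) hs
  have hT₀0 : 0 ≤ T₀ := hT₁0.trans hT₁
  -- `q ≤ ½`
  have hqhalf : cq / P ^ 6 ≤ 1 / 2 := by
    rw [div_le_iff₀ (by positivity)]
    nlinarith only [hPq, hP6, hcq]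
  -- the far terms: `D(4/3)^D T₀ / LB ≤ 1/(2P⁹)`
  have hfar' : D * (4 / 3 : ℝ) ^ D * T₀ / LB ≤ 1 / (2 * P ^ 9) := by
    rw [div_le_iff₀ hLB]
    calc D * (4 / 3 : ℝ) ^ D * T₀ ≤ LB / (2 * P ^ 9) := hfar
      _ = 1 / (2 * P ^ 9) * LB := by ring
  have hfar1 : D * (4 / 3 : ℝ) ^ D * T₀ / LB ≤ 1 / (2 * P) := by
    refine hfar'.trans ?_
    exact div_le_div_of_nonneg_left (by norm_num) (by positivity) (by nlinarith only [hP9, hP0])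
  -- `Γ q ≤ cΓ cq / P⁵`
  have hΓq₀ : Γ₀ * q₀ ≤ cΓ * cq / P ^ 5 := by
    calc Γ₀ * q₀ ≤ (cΓ * P) * (cq / P ^ 6) := mul_le_mul hΓ₀ hq₀ hq₀0 (by positivity)
      _ = cΓ * cq / P ^ 5 := by field_simp
  have hΓq₁ : Γ₁ * q₁ ≤ cΓ * cq / P ^ 5 := by
    calc Γ₁ * q₁ ≤ (cΓ * P) * (cq / P ^ 6) := mul_le_mul hΓ₁ hq₁ hq₁0 (by positivity)
      _ = cΓ * cq / P ^ 5 := by field_simp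
  have hΓq5 : cΓ * cq / P ^ 5 ≤ cΓ * cq / P := div_le_div_of_nonneg_left (by positivity) hP0 hP5
  -- `ε_C ≤ ¼`
  have hεC : 2 * Γ₀ * q₀ + D * (4 / 3 : ℝ) ^ D * T₀ / LB ≤ 1 / 4 := by
    have h1 : 2 * Γ₀ * q₀ ≤ 2 * (cΓ * cq / P) := by linarith only [hΓq₀, hΓq5]
    have hinv : 1 / P ≤ 1 / (4 * (2 * cΓ * cq + 1)) := one_div_le_one_div_of_le (by positivity) hPC
    have e1 : 2 * (cΓ * cq / P) + 1 / (2 * P) = (2 * cΓ * cq + 1 / 2) * (1 / P) := by ring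
    have e2 : (2 * cΓ * cq + 1 / 2) * (1 / (4 * (2 * cΓ * cq + 1))) ≤ 1 / 4 := by
      rw [mul_one_div, div_le_iff₀ (by positivity)]; nlinarith only [hcΓ, hcq]
    have h3 : (2 * cΓ * cq + 1 / 2) * (1 / P) ≤ (2 * cΓ * cq + 1 / 2) * (1 / (4 * (2 * cΓ * cq + 1))) :=
      mul_le_mul_of_nonneg_left hinv (by positivity)
    linarith only [h1, hfar1, e1, e2, h3]
  -- `ε_B ≤ ¼`: the main term
  have hmain : m * (Γ₁ * (2 * q₁ + 3 * D / s) + 2 * Γ₀ * q₀) ≤ (4 * cΓ * cq + 6 * cΓ / β) * P ^ 3 := by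
    have hq₁' : q₁ * P ^ 6 ≤ cq := (le_div_iff₀ (by positivity)).1 hq₁
    have hq₀' : q₀ * P ^ 6 ≤ cq := (le_div_iff₀ (by positivity)).1 hq₀
    -- `m Γ₁ q₁ ≤ cΓ cq P³`, `m Γ₀ q₀ ≤ cΓ cq P³`
    have t1 : m * Γ₁ ≤ P ^ 8 * (cΓ * P) := mul_le_mul hm hΓ₁ hΓ₁0 (by positivity)
    have t0 : m * Γ₀ ≤ P ^ 8 * (cΓ * P) := mul_le_mul hm hΓ₀ hΓ₀0 (by positivity)
    have u1 : m * Γ₁ * q₁ ≤ cΓ * cq * P ^ 3 := by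
      calc m * Γ₁ * q₁ ≤ P ^ 8 * (cΓ * P) * q₁ := mul_le_mul_of_nonneg_right t1 hq₁0
        _ = cΓ * P ^ 3 * (q₁ * P ^ 6) := by ring
        _ ≤ cΓ * P ^ 3 * cq := mul_le_mul_of_nonneg_left hq₁' (by positivity)
        _ = cΓ * cq * P ^ 3 := by ring
    have u0 : m * Γ₀ * q₀ ≤ cΓ * cq * P ^ 3 := by
      calc m * Γ₀ * q₀ ≤ P ^ 8 * (cΓ * P) * q₀ := mul_le_mul_of_nonneg_right t0 hq₀0
        _ = cΓ * P ^ 3 * (q₀ * P ^ 6) := by ring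
        _ ≤ cΓ * P ^ 3 * cq := mul_le_mul_of_nonneg_left hq₀' (by positivity)
        _ = cΓ * cq * P ^ 3 := by ring
    -- `m Γ₁ (3D/s) ≤ 6 cΓ P³ / β`
    have hy0 : 0 ≤ 3 * D / s := by positivity
    have hy : β * P ^ 8 * (3 * D / s) ≤ 6 * P ^ 2 := by
      have e : s * (3 * D / s) = 3 * D := by field_simp
      have h1 : β * P ^ 8 * (3 * D / s) ≤ s * (3 * D / s) := mul_le_mul_of_nonneg_right hs hy0
      rw [e] at h1; linarith only [h1, hD]
    have u2 : m * Γ₁ * (3 * D / s) ≤ 6 * cΓ / β * P ^ 3 := by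
      calc m * Γ₁ * (3 * D / s) ≤ P ^ 8 * (cΓ * P) * (3 * D / s) := mul_le_mul_of_nonneg_right t1 hy0
        _ = cΓ * P / β * (β * P ^ 8 * (3 * D / s)) := by field_simp
        _ ≤ cΓ * P / β * (6 * P ^ 2) := mul_le_mul_of_nonneg_left hy (by positivity)
        _ = 6 * cΓ / β * P ^ 3 := by ring
    have e : m * (Γ₁ * (2 * q₁ + 3 * D / s) + 2 * Γ₀ * q₀) = 2 * (m * Γ₁ * q₁) + m * Γ₁ * (3 * D / s) + 2 * (m * Γ₀ * q₀) := by ring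
    rw [e]; nlinarith only [u1, u0, u2]
  -- `ε_B ≤ ¼`: the far term
  have htail : D * (4 / 3 : ℝ) ^ D * ((2 * s / n + 4 * D / n) * (a * T₁) + m * T₀) / LB ≤ 3 / (2 * P) := by
    have h1 : 2 * s / n ≤ 1 := by rw [hn, div_le_one (by positivity)]; linarith only [hs']
    have h2 : 4 * D / n ≤ 1 := by
      rw [hn, div_le_one (by positivity)]
      have h64 : (64 : ℝ) ≤ P ^ 6 := by
        have := pow_le_pow_left₀ (by norm_num : (0 : ℝ) ≤ 2) hP2 6
        norm_num at this; exact this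
      have e : P ^ 8 = P ^ 6 * P ^ 2 := by ring
      have hP2sq : 0 ≤ P ^ 2 := by positivity
      nlinarith only [hD, h64, e, hP2sq]
    have h3 : (2 * s / n + 4 * D / n) * (a * T₁) ≤ 2 * (P ^ 8 * T₀) := by
      have ha' : a * T₁ ≤ P ^ 8 * T₀ := mul_le_mul ha hT₁ hT₁0 (by positivity)
      have hc2 : 2 * s / n + 4 * D / n ≤ 2 := by linarith only [h1, h2]
      calc (2 * s / n + 4 * D / n) * (a * T₁) ≤ 2 * (a * T₁) := mul_le_mul_of_nonneg_right hc2 (mul_nonneg ha0 hT₁0)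
        _ ≤ 2 * (P ^ 8 * T₀) := by linarith only [ha']
    have h4 : m * T₀ ≤ P ^ 8 * T₀ := mul_le_mul_of_nonneg_right hm hT₀0
    have h5 : D * (4 / 3 : ℝ) ^ D * ((2 * s / n + 4 * D / n) * (a * T₁) + m * T₀) ≤ D * (4 / 3 : ℝ) ^ D * (3 * (P ^ 8 * T₀)) :=
      mul_le_mul_of_nonneg_left (by linarith only [h3, h4]) (by positivity)
    have h6 : D * (4 / 3 : ℝ) ^ D * (3 * (P ^ 8 * T₀)) / LB = 3 * P ^ 8 * (D * (4 / 3 : ℝ) ^ D * T₀ / LB) := by ring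
    have h7 : 3 * P ^ 8 * (D * (4 / 3 : ℝ) ^ D * T₀ / LB) ≤ 3 * P ^ 8 * (1 / (2 * P ^ 9)) :=
      mul_le_mul_of_nonneg_left hfar' (by positivity)
    have h8 : 3 * P ^ 8 * (1 / (2 * P ^ 9)) = 3 / (2 * P) := by field_simp
    calc _ ≤ D * (4 / 3 : ℝ) ^ D * (3 * (P ^ 8 * T₀)) / LB := div_le_div_of_nonneg_right h5 hLB.le
      _ = _ := h6
      _ ≤ 3 / (2 * P) := by rw [← h8]; exact h7
  have hεB : (m * (Γ₁ * (2 * q₁ + 3 * D / s) + 2 * Γ₀ * q₀) +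
      D * (4 / 3 : ℝ) ^ D * ((2 * s / n + 4 * D / n) * (a * T₁) + m * T₀) / LB) / r ≤ 1 / 4 := by
    have hnum : m * (Γ₁ * (2 * q₁ + 3 * D / s) + 2 * Γ₀ * q₀) +
        D * (4 / 3 : ℝ) ^ D * ((2 * s / n + 4 * D / n) * (a * T₁) + m * T₀) / LB ≤ K * P ^ 3 := by
      have h1 : 3 / (2 * P) ≤ 2 * P ^ 3 := by
        rw [div_le_iff₀ (by positivity)]
        have : (1 : ℝ) ≤ P ^ 3 := one_le_pow₀ hP1
        nlinarith only [this, hP1]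
      rw [hK]; nlinarith only [hmain, htail, h1, hP0]
    rw [div_le_iff₀ hr0]
    refine hnum.trans ?_
    -- `K P³ ≤ r/4` from `cr P⁴ ≤ r` and `4K/cr ≤ P`
    have h2 : K * P ^ 3 * (4 / cr) ≤ P ^ 4 := by
      calc K * P ^ 3 * (4 / cr) = (4 * K / cr) * P ^ 3 := by ring
        _ ≤ P * P ^ 3 := mul_le_mul_of_nonneg_right hPK (by positivity)
        _ = P ^ 4 := by ring
    have h3 : K * P ^ 3 ≤ cr * P ^ 4 / 4 := by
      rw [le_div_iff₀ (by norm_num)]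
      have := mul_le_mul_of_nonneg_left h2 hcr.le
      have e : cr * (K * P ^ 3 * (4 / cr)) = K * P ^ 3 * 4 := by field_simp
      linarith only [this, e]
    linarith only [h3, hr]
  exact ⟨hεB, hεC, hq₀.trans hqhalf, hq₁.trans hqhalf⟩

end Summit.PneNP.PneNP.Theorems.ChebyshevTracialDesignGammaDirectionNumericsBC

end
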